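import Mathlib
import Summits.KontsevichZagierPeriods.KontsevichZagierPeriods.Theorems.TorsionLogsGKZLevelThreePairBetaArctan
import HarnessLib

/-!
# `BetaLinearSector` (stmt-KontsevichZagierPeriods-3897), line `fermat-sector-transport` —
# stub `stub_quarticRational_equivalent_half` (Euler's reflection at `1/4`, step 2)

The LEVEL-4 rung (`a, b, a', b' ∈ ¼ℤ`) of the crux `BetaLinearSector` (route FermatIsogeny) needs
Euler's reflection formula at `1/4`, `sin(π/4) · B(1/4, 3/4) = π`, INSIDE the Kontsevich–Zagier
calculus.  Step 1 (`stub_quarticRational_equivalent_beta`) makes `B(1/4, 3/4)` rational: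
`[(0,1), x^{-3/4}(1-x)^{-1/4}] ∼ W = [(0,1), f]`, `f(w) = 4(1-w)²/Q(w)`, `Q(w) = w⁴ + (1-w)⁴ > 0`.
This file is step 2, the symmetry `w ↦ 1 - w` of `Q`:

* `stub_quarticRational_equivalent_half` — split `W` at the algebraic abscissa `1/2` (rule 1a), the
  point `1/2` is a null slice), carry the upper half `[(1/2,1), f]` to
  `[(0,1/2), f(1-w)] = [(0,1/2), 4w²/Q]` by the reflection `w ↦ 1-w` (rule 2), `Q(1-w) = Q(w)`),
  and add the integrands `4(1-w)²/Q + 4w²/Q = 4((1-w)² + w²)/Q` (rule 1b)):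
  `W ∼ H = [(0,1/2), 4((1-w)² + w²)/Q]`.

The proof copies the level-3 template `GKZLevelThree.cubicRational_equivalent_half`
(`[(0,1), 3w/q] ∼ [(0,1/2), 3/q]`, `q = 3w²-3w+1`).  All representations are PINNED by their domain
and their integrand on it.

## References

* M. Kontsevich, D. Zagier, *Periods* (2001), §1.2 rules (1)–(2).
* G. Andrews, R. Askey, R. Roy, *Special Functions* (1999), Thm. 1.2.1 (Euler's reflection formula).
-/

noncomputable section

namespace Summit.KontsevichZagierPeriods.FermatIsogeny.BetaLinearSector.Quarters

open Set MeasureTheory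
open MvPolynomial (aeval X C)
open Literature.NumberTheory.Transcendental Literature.NumberTheory.Transcendental.KZ
open Literature.ModelTheory.ExponentialFields (IsSemialgebraic)
open Summit.KontsevichZagierPeriods.HermiteRigidity.CMTwistQuasiPeriodTransfer
  (isSemialgebraic_setOf_apply_lt_of_isAlgebraic isSemialgebraic_setOf_apply_gt_of_isAlgebraic
    of_sub_of_sub_mem_relations_split)
open Summit.KontsevichZagierPeriods.KontsevichZagierPeriods.Theorems.GKZLevelThree
  (exists_rep_Ioo₁ isSemialgebraicFunOn_ratFun₁)

/-- The quartic denominator `Q(w) = w⁴ + (1-w)⁴ = 1/8 + 3(w-1/2)² + 2(w-1/2)⁴` is positive.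
[folklore] -/
theorem quarticHalf_den_pos (w : ℝ) : 0 < w ^ 4 + (1 - w) ^ 4 := by
  nlinarith [sq_nonneg (w - 1 / 2), sq_nonneg ((w - 1 / 2) ^ 2)]

/-- **Step 2 of Euler's reflection at `1/4`.** `[(0,1), 4(1-w)²/Q] ∼ [(0,1/2), 4((1-w)²+w²)/Q]`,
`Q = w⁴ + (1-w)⁴ = Q(1-w)`: split at the algebraic abscissa `1/2` (rule 1a)), carry the upper half
to `[(0,1/2), 4w²/Q]` by the reflection `w ↦ 1-w` (rule 2)), and add
`4(1-w)²/Q + 4w²/Q = 4((1-w)²+w²)/Q` (rule 1b)).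
[cite: KontsevichZagier2001, §1.2 rules (1), (2)] -/
theorem stub_quarticRational_equivalent_half : ∀ (W H : KZ.IntegralRep 1), W.domain = {x | x 0 ∈ Set.Ioo (0:ℝ) 1} → Set.EqOn W.integrand (fun x => 4 * (1 - x 0) ^ 2 / ((x 0) ^ 4 + (1 - x 0) ^ 4)) W.domain → H.domain = {x | 0 < x 0 ∧ x 0 < 1 / 2} → Set.EqOn H.integrand (fun x => 4 * ((1 - x 0) ^ 2 + (x 0) ^ 2) / ((x 0) ^ 4 + (1 - x 0) ^ 4)) H.domain → KZ.Equivalent W H := by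
  intro W H hWd hWi hHd hHi
  have hhalf : IsAlgebraic ℚ ((1:ℝ) / 2) := by
    simpa using isAlgebraic_algebraMap (R := ℚ) (A := ℝ) (1 / 2 : ℚ)
  -- the two halves of `W`
  have hs₁ : IsSemialgebraic ℚ (W.domain ∩ {p : Fin 1 → ℝ | p 0 < 1 / 2}) :=
    W.isSemialgebraic_domain.inter (isSemialgebraic_setOf_apply_lt_of_isAlgebraic hhalf 0)
  have hs₂ : IsSemialgebraic ℚ (W.domain ∩ {p : Fin 1 → ℝ | 1 / 2 < p 0}) :=
    W.isSemialgebraic_domain.inter (isSemialgebraic_setOf_apply_gt_of_isAlgebraic hhalf 0)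
  set W₁ := W.restrict _ hs₁ inter_subset_left with hW₁
  set W₂ := W.restrict _ hs₂ inter_subset_left with hW₂
  have hsplit : of W - of W₁ - of W₂ ∈ relations :=
    of_sub_of_sub_mem_relations_split W W₁ W₂ hhalf rfl rfl (fun _ _ => rfl) (fun _ _ => rfl)
  have hW₁d : W₁.domain = {x : Fin 1 → ℝ | 0 < x 0 ∧ x 0 < 1 / 2} := by
    rw [hW₁, IntegralRep.domain_restrict, hWd]
    ext x
    simp only [mem_inter_iff, mem_setOf_eq, mem_Ioo]
    constructor
    · rintro ⟨⟨h1, -⟩, h2⟩; exact ⟨h1, h2⟩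
    · rintro ⟨h1, h2⟩; exact ⟨⟨h1, by linarith⟩, h2⟩
  have hW₂d : W₂.domain = {x : Fin 1 → ℝ | 1 / 2 < x 0 ∧ x 0 < 1} := by
    rw [hW₂, IntegralRep.domain_restrict, hWd]
    ext x
    simp only [mem_inter_iff, mem_setOf_eq, mem_Ioo]
    constructor
    · rintro ⟨⟨-, h1⟩, h2⟩; exact ⟨h2, h1⟩
    · rintro ⟨h1, h2⟩; exact ⟨⟨by linarith, h2⟩, h1⟩
  -- the reflected upper half `W₂' = [(0,1/2), 4w²/Q]`
  obtain ⟨W₂', hW₂'d, hW₂'i⟩ : ∃ r : IntegralRep 1, r.domain = {x : Fin 1 → ℝ | 0 < x 0 ∧ x 0 < 1 / 2} ∧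
      r.integrand = fun x => 4 * x 0 ^ 2 / (x 0 ^ 4 + (1 - x 0) ^ 4) := by
    refine exists_rep_Ioo₁ isAlgebraic_zero hhalf (fun w => 4 * w ^ 2 / (w ^ 4 + (1 - w) ^ 4))
      ((by fun_prop : Continuous fun w : ℝ => 4 * w ^ 2).continuousOn.div (by fun_prop)
        fun w _ => (quarticHalf_den_pos w).ne') ?_
    refine isSemialgebraicFunOn_ratFun₁ (((KZ.isSemialgebraic_setOf_const_lt_apply isAlgebraic_zero 0).inter (KZ.isSemialgebraic_setOf_apply_lt_const hhalf 0)))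
      (C 4 * X 0 ^ 2) (X 0 ^ 4 + (1 - X 0) ^ 4)
      (fun w => 4 * w ^ 2 / (w ^ 4 + (1 - w) ^ 4)) (fun x _ => ?_) (fun x _ => ?_)
    · simp only [map_add, map_sub, map_pow, MvPolynomial.aeval_X, map_one]
      exact (quarticHalf_den_pos (x 0)).ne'
    · simp
  have hrefl : of W₂' - of W₂ ∈ relations := by
    refine of_sub_of_mem_relations_of_boxReflection (0 : Fin 1) ?_ fun x hx => ?_
    · rw [hW₂'d, hW₂d]
      ext x
      simp only [mem_setOf_eq, mem_preimage, boxReflection_apply_self]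
      constructor <;> rintro ⟨h1, h2⟩ <;> constructor <;> linarith
    · have hx' : 0 < x 0 ∧ x 0 < 1 / 2 := by rw [hW₂'d] at hx; exact hx
      have hmem : boxReflection (0 : Fin 1) x ∈ W.domain := by
        rw [hWd]
        show boxReflection 0 x 0 ∈ Ioo (0:ℝ) 1
        rw [boxReflection_apply_self]
        exact ⟨by linarith [hx'.2], by linarith [hx'.1]⟩
      rw [hW₂'i, hW₂, IntegralRep.integrand_restrict, hWi hmem]
      simp only [boxReflection_apply_self]
      ring
  -- integrand additivity on `(0,1/2)`
  have hadd : of H - of W₁ - of W₂' ∈ relations := by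
    refine integrandAddRel_subset_relations ⟨1, H, W₁, W₂', by rw [hW₁d, hHd], by rw [hW₂'d, hHd],
      fun x hx => ?_, rfl⟩
    have hx' : 0 < x 0 ∧ x 0 < 1 / 2 := by rw [hHd] at hx; exact hx
    have hmem : x ∈ W.domain := by rw [hWd]; exact ⟨hx'.1, by linarith [hx'.2]⟩
    rw [hHi hx, Pi.add_apply, hW₁, IntegralRep.integrand_restrict, hWi hmem, hW₂'i]
    ring
  have : of W - of H = (of W - of W₁ - of W₂) - (of H - of W₁ - of W₂') - (of W₂' - of W₂) := by abel
  show of W - of H ∈ relations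
  rw [this]
  exact relations.sub_mem (relations.sub_mem hsplit hadd) hrefl

end Summit.KontsevichZagierPeriods.FermatIsogeny.BetaLinearSector.Quarters

end
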